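import Mathlib
import Summits.QuantumFields.BalabanUV.Beta.FP.StationarityK
import Summits.QuantumFields.BalabanUV.Beta.GAN24.CombesThomas

/-!
# Road «FP» (binder row D1), OWNER RULING R-FP-8: the REBASED jet families — unit-compensated block-constant embedding `j = m·j′`

OWNER-RULINGS-FP-1 ADDENDUM (R-FP-8 = gan24-p1-g6's option (a), journal 2026-08-20): road FP's (j,m) jet families OF RECORD are the
REBASED WALL FAMILIES — member `m` is the wall family of ONE step at base `Lc^m`, whose natural level index is `j′` (fine level `m·j′`).
Road FP's END (`FP/StepLawKHolds.d1Drift_JsBalOf_of_rows_bounded`) reads a family `S : ℕ → ℕ → stencil` in the base-`Lc` units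
`(sfStep Lc j, smStep d Lc j)` through `SPerfOf (sfStep Lc) (smStep d Lc) S m = limStOf (j ↦ unitS (sfStep Lc j) (smStep d Lc j) (S j m))`.
This file is the owner's bookkeeping (gan24-p1-g6 l.12885 (ii)): embed a base-`Lc^m` sequence `U j′` (already in ITS units
`(sfStep (Lc^m) j′, smStep d (Lc^m) j′)`) as the `j`-indexed family `rebaseS Lc m SL j := unitS (compensation) (SL (j / m))` so that
  `unitS (sfStep Lc j) (smStep d Lc j) (rebaseS … j) = unitS (sfStep (Lc^m) (j/m)) (smStep d (Lc^m) (j/m)) (SL (j/m))`   (`unitS_rebaseS`)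
and hence, when the base-`Lc^m` unit sequence converges entrywise, the perfect object is the SAME limit:
  `limStOf (j ↦ unitS (sfStep Lc j) (smStep d Lc j) (rebaseS … j)) = limStOf (j′ ↦ unitS (sfStep (Lc^m) j′) (smStep d (Lc^m) j′) (SL j′))`
(`limStOf_rebaseS`), so that `LocStencil` class data at base `Lc^m` (gan24's slot rows instantiated at `Lc := Lc^m`, module
`GAN24/SlotRowsPowBase.lean`) transfer verbatim (`locStencil_limStOf_rebaseS`).  Second-order twin `rebaseW` likewise.
[our object]/[folklore]; nothing about Bałaban's objects is asserted (`SL`, `WL` are arbitrary families).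
HONEST FRAMING: bookkeeping toward `hident` (GAPS O-asym1-7); discharges nothing of `BetaPertH`; NOT the continuum limit, NOT Clay.
-/

noncomputable section

namespace Summit.QuantumFields.BalabanUV.Beta.FP.RebaseJets

open Filter Topology
open Literature.MathematicalPhysics.QuantumFieldTheory.Balaban1983to89
open Literature.MathematicalPhysics.QuantumFieldTheory.Balaban1983to89.Beta
open ExpKernelCalculus (MKer BiLoc)
open OneStepResolventKernel (Fib LocStencil)
open HessKerDressedLimit (limMKerOf limStOf limTabOf limMKerOf_apply limMKerOf_eq_of_tendsto)
open Summit.QuantumFields.BalabanUV.Beta.HessKerDressedUnits (legScale unitS unitW counitK unitS_apply unitW_apply counitK_apply unitS_one unitW_one)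
open Summit.QuantumFields.BalabanUV.Beta.FP.StationarityK (legScale_mul)
open Summit.QuantumFields.BalabanUV.Beta.GAN24.CombesThomas (sfStep smStep sfStep_ne_zero smStep_ne_zero)

variable {d : ℕ}

/-! ## §1 Composition of unit changes -/

/-- [folklore] Stencil unit changes compose multiplicatively. -/
theorem unitS_unitS (rf rm sf sm : ℝ) (S : Fin (d + 1) → (Fin (d + 1) → ℤ) → MKer (d + 1) (Fib d)) :
    unitS rf rm (unitS sf sm S) = unitS (rf * sf) (rm * sm) S := by
  funext κ u x y a b
  simp only [unitS_apply, mul_inv, legScale_mul]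
  ring

/-- [folklore] Second-order table unit changes compose multiplicatively. -/
theorem unitW_unitW (rf rm sf sm : ℝ) (W : Fin (d + 1) → (Fin (d + 1) → ℤ) → Fin (d + 1) → (Fin (d + 1) → ℤ) → MKer (d + 1) (Fib d)) :
    unitW rf rm (unitW sf sm W) = unitW (rf * sf) (rm * sm) W := by
  funext μ y ν y' x z a b
  simp only [unitW_apply, mul_inv, legScale_mul]
  ring

/-! ## §2 The unit-compensated block-constant embedding -/

/-- [our object] The field-unit compensation factor on the block of `j`: `sfStep (Lc^m) (j/m) / sfStep Lc j`. -/
def cf (Lc m j : ℕ) : ℝ := sfStep (Lc ^ m) (j / m) / sfStep Lc j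

/-- [our object] The multiplier-unit compensation factor: `smStep d (Lc^m) (j/m) / smStep d Lc j`. -/
def cm (d Lc m j : ℕ) : ℝ := smStep d (Lc ^ m) (j / m) / smStep d Lc j

/-- [our object] **The rebased stencil family**: member `j` := the base-`Lc^m` member `j / m`, unit-compensated. -/
def rebaseS (Lc m : ℕ) (SL : ℕ → Fin (d + 1) → (Fin (d + 1) → ℤ) → MKer (d + 1) (Fib d)) (j : ℕ) :
    Fin (d + 1) → (Fin (d + 1) → ℤ) → MKer (d + 1) (Fib d) :=
  unitS (cf Lc m j) (cm d Lc m j) (SL (j / m))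

/-- [our object] **The rebased second-order family**. -/
def rebaseW (Lc m : ℕ) (WL : ℕ → Fin (d + 1) → (Fin (d + 1) → ℤ) → Fin (d + 1) → (Fin (d + 1) → ℤ) → MKer (d + 1) (Fib d)) (j : ℕ) :
    Fin (d + 1) → (Fin (d + 1) → ℤ) → Fin (d + 1) → (Fin (d + 1) → ℤ) → MKer (d + 1) (Fib d) :=
  unitW (cf Lc m j) (cm d Lc m j) (WL (j / m))

/-- [folklore] **The base-`Lc` units of the rebased family are the base-`Lc^m` units of the original**: on the block of `j`,
`unitS (sfStep Lc j) (smStep d Lc j) (rebaseS Lc m SL j) = unitS (sfStep (Lc^m) (j/m)) (smStep d (Lc^m) (j/m)) (SL (j/m))`. -/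
theorem unitS_rebaseS {Lc : ℕ} [NeZero Lc] (m : ℕ) (SL : ℕ → Fin (d + 1) → (Fin (d + 1) → ℤ) → MKer (d + 1) (Fib d)) (j : ℕ) :
    unitS (sfStep Lc j) (smStep d Lc j) (rebaseS Lc m SL j) = unitS (sfStep (Lc ^ m) (j / m)) (smStep d (Lc ^ m) (j / m)) (SL (j / m)) := by
  unfold rebaseS cf cm
  rw [unitS_unitS, mul_div_cancel₀ _ (sfStep_ne_zero j), mul_div_cancel₀ _ (smStep_ne_zero (d := d) j)]

/-- [folklore] Second-order twin of `unitS_rebaseS`. -/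
theorem unitW_rebaseW {Lc : ℕ} [NeZero Lc] (m : ℕ)
    (WL : ℕ → Fin (d + 1) → (Fin (d + 1) → ℤ) → Fin (d + 1) → (Fin (d + 1) → ℤ) → MKer (d + 1) (Fib d)) (j : ℕ) :
    unitW (sfStep Lc j) (smStep d Lc j) (rebaseW Lc m WL j) = unitW (sfStep (Lc ^ m) (j / m)) (smStep d (Lc ^ m) (j / m)) (WL (j / m)) := by
  unfold rebaseW cf cm
  rw [unitW_unitW, mul_div_cancel₀ _ (sfStep_ne_zero j), mul_div_cancel₀ _ (smStep_ne_zero (d := d) j)]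

/-- [folklore] At `m = 1` the rebasing is the identity (`Lc^1 = Lc`, `j/1 = j`, compensation `1`). -/
theorem rebaseS_one {Lc : ℕ} [NeZero Lc] (SL : ℕ → Fin (d + 1) → (Fin (d + 1) → ℤ) → MKer (d + 1) (Fib d)) (j : ℕ) :
    rebaseS Lc 1 SL j = SL j := by
  unfold rebaseS cf cm
  rw [pow_one, Nat.div_one, div_self (sfStep_ne_zero j), div_self (smStep_ne_zero (d := d) j), unitS_one]

/-- [folklore] Second-order twin of `rebaseS_one`. -/
theorem rebaseW_one {Lc : ℕ} [NeZero Lc]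
    (WL : ℕ → Fin (d + 1) → (Fin (d + 1) → ℤ) → Fin (d + 1) → (Fin (d + 1) → ℤ) → MKer (d + 1) (Fib d)) (j : ℕ) :
    rebaseW Lc 1 WL j = WL j := by
  unfold rebaseW cf cm
  rw [pow_one, Nat.div_one, div_self (sfStep_ne_zero j), div_self (smStep_ne_zero (d := d) j), unitW_one]

/-! ## §3 Same limit: the perfect object of the rebased family is the base-`Lc^m` limit -/

/-- [folklore] A convergent sequence read along `j ↦ j / m` (`m ≠ 0`) has the same limit. -/
theorem tendsto_comp_div {f : ℕ → ℝ} {c : ℝ} (hf : Tendsto f atTop (𝓝 c)) {m : ℕ} (hm : m ≠ 0) :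
    Tendsto (fun j => f (j / m)) atTop (𝓝 c) :=
  hf.comp (Nat.tendsto_div_const_atTop hm)

/-- [folklore] **Same constructed limit**: if the base-`Lc^m` unit sequence converges entrywise to its constructed limit, the rebased
family's base-`Lc` unit sequence has the same `limStOf`. -/
theorem limStOf_rebaseS {Lc : ℕ} [NeZero Lc] {m : ℕ} (hm : m ≠ 0)
    (SL : ℕ → Fin (d + 1) → (Fin (d + 1) → ℤ) → MKer (d + 1) (Fib d))
    (hconv : ∀ κ u x y a b, Tendsto (fun j' => unitS (sfStep (Lc ^ m) j') (smStep d (Lc ^ m) j') (SL j') κ u x y a b) atTop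
      (𝓝 (limStOf (fun j' => unitS (sfStep (Lc ^ m) j') (smStep d (Lc ^ m) j') (SL j')) κ u x y a b))) :
    limStOf (fun j => unitS (sfStep Lc j) (smStep d Lc j) (rebaseS Lc m SL j))
      = limStOf (fun j' => unitS (sfStep (Lc ^ m) j') (smStep d (Lc ^ m) j') (SL j')) := by
  funext κ u
  simp only [limStOf]
  refine limMKerOf_eq_of_tendsto fun x y a b => ?_
  simp only [unitS_rebaseS]
  exact tendsto_comp_div (hconv κ u x y a b) hm

/-- [folklore] Second-order twin of `limStOf_rebaseS`. -/
theorem limTabOf_rebaseW {Lc : ℕ} [NeZero Lc] {m : ℕ} (hm : m ≠ 0)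
    (WL : ℕ → Fin (d + 1) → (Fin (d + 1) → ℤ) → Fin (d + 1) → (Fin (d + 1) → ℤ) → MKer (d + 1) (Fib d))
    (hconv : ∀ μ y ν y' x z a b, Tendsto (fun j' => unitW (sfStep (Lc ^ m) j') (smStep d (Lc ^ m) j') (WL j') μ y ν y' x z a b) atTop
      (𝓝 (limTabOf (fun j' => unitW (sfStep (Lc ^ m) j') (smStep d (Lc ^ m) j') (WL j')) μ y ν y' x z a b))) :
    limTabOf (fun j => unitW (sfStep Lc j) (smStep d Lc j) (rebaseW Lc m WL j))
      = limTabOf (fun j' => unitW (sfStep (Lc ^ m) j') (smStep d (Lc ^ m) j') (WL j')) := by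
  funext μ y ν y'
  simp only [limTabOf]
  refine limMKerOf_eq_of_tendsto fun x z a b => ?_
  simp only [unitW_rebaseW]
  exact tendsto_comp_div (hconv μ y ν y' x z a b) hm

/-! ## §4 Class data transfer: `LocStencil` / `VertexFamily₂` of the base-`Lc^m` limit ARE those of the rebased perfect object -/

/-- [folklore] **hSinf BY REBASE**: uniform `LocStencil` + geometric Cauchy rate of the base-`Lc^m` unit sequence (gan24's S-slot rows at
base `Lc^m`) give `LocStencil` of the rebased family's perfect stencil `limStOf (j ↦ unitS (sfStep Lc j) (smStep d Lc j) (rebaseS … j))`. -/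
theorem locStencil_limStOf_rebaseS {Lc : ℕ} [NeZero Lc] {m : ℕ} (hm : m ≠ 0)
    (SL : ℕ → Fin (d + 1) → (Fin (d + 1) → ℤ) → MKer (d + 1) (Fib d)) {Cs c δ δ' θ : ℝ}
    (hS : ∀ j', LocStencil (unitS (sfStep (Lc ^ m) j') (smStep d (Lc ^ m) j') (SL j')) Cs δ')
    (hSall : ∀ k j', LocStencil (unitS (sfStep (Lc ^ m) (k + j')) (smStep d (Lc ^ m) (k + j')) (SL (k + j'))
      - unitS (sfStep (Lc ^ m) k) (smStep d (Lc ^ m) k) (SL k)) (c * θ ^ k) δ)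
    (hθ0 : 0 ≤ θ) (hθ1 : θ < 1) :
    LocStencil (limStOf (fun j => unitS (sfStep Lc j) (smStep d Lc j) (rebaseS Lc m SL j))) Cs δ' := by
  set U : ℕ → Fin (d + 1) → (Fin (d + 1) → ℤ) → MKer (d + 1) (Fib d) :=
    fun j' => unitS (sfStep (Lc ^ m) j') (smStep d (Lc ^ m) j') (SL j') with hU
  have hconv : ∀ κ u x y a b, Tendsto (fun j' => U j' κ u x y a b) atTop (𝓝 (limStOf U κ u x y a b)) := by
    intro κ u x y a b
    have hr := HessKerDressedLimit.locStencil_sub_limStOf (S := U) (fun k j => hSall k j) hθ1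
    -- `|U k − lim| ≤ c·θ^k·e^{…}` entrywise ⇒ convergence
    exact HessKerDressedLimit.tendsto_of_biLoc_rate (T := fun k => U k κ u) (Tinf := limStOf U κ u) (p := u) (q := u)
      (c := c) (δ := δ) (fun k => by simpa only [Pi.sub_apply] using hr k κ u) hθ0 hθ1 x y a b
  rw [limStOf_rebaseS hm SL hconv]
  exact HessKerDressedLimit.locStencil_limStOf hS hSall hθ1

end Summit.QuantumFields.BalabanUV.Beta.FP.RebaseJets

end
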